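import Mathlib
import HarnessLib
import Summits.NavierStokesRegularity.NavierStokesRegularity.Theorems.HalfSpaceWindowDoorCirculationCarryingRigidityWholeSpaceMaxPrinciple

/-!
# Route `HalfSpaceWindowDoor`, crux `CirculationCarryingRigidity` (stmt-NavierStokesRegularity-25311) — tool: the whole-space weak maximum
# principle in PENALISED form — the subsolution inequality is needed only at a point which is a GLOBAL MAXIMUM of the penalised
# comparison `q − εψ_t`, with positive time derivative and gradient `2εe^{K(t−s₀)}x`

Line `eddy_covariance` (LEAD ns-hsw-p1 g10).  Strengthening of `…TouchingMaxPrinciple.le_of_subsolution_touching` (same proof, Friedman 1964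
Ch. 2 §4 barrier `ψ(t,x) = e^{K(t−s₀)}(1 + ‖x‖²)`, `K = 2Λ + 6`): at the one point where g5's proof of `…WholeSpaceMaxPrinciple.le_of_subsolution`
uses the inequality, the SLICE `y ↦ q(t,y) − εψ(t,y)` attains its GLOBAL maximum over `ℝ³` (inside the ball by construction, outside by the
far-field bound), in addition to `∂ₜq > 0`, `∇q = ε∇ψ_t(x)`, `0 < ε ≤ ε₀`, `ε(1+‖x‖²) ≤ q − m`.  `le_of_subsolution_penalised` hands all of
this to the user.  For the circulation of a closed-hemisphere profile (`…FlatBarrier`) the global maximum says that the touching circle is an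
`η`-LOCAL MAXIMUM of the circulation landscape `Γ(·,·,t)` in its parabolic neighbourhood, besides being flat and growing.
WHAT THIS IS NOT: not about NS regularity; a linear parabolic tool; helper `--supports` 25311.
-/

noncomputable section

-- the summit and its single sub-problem share the name (CONVENTIONS §1), as in every Theorems file
set_option linter.dupNamespace false

namespace Summit.NavierStokesRegularity.NavierStokesRegularity.Theorems.HalfSpaceWindowDoorCirculationCarryingRigidityPenalisedMaxPrinciple

open Set Function Filter Topology InnerProductSpace Metric
open scoped Laplacian RealInnerProductSpace ContDiff Topology
open Literature.Analysis Literature.Analysis.FluidPDE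
open Summit.NavierStokesRegularity.NavierStokesRegularity.Theorems.HalfSpaceWindowDoorCirculationCarryingRigidityWholeSpaceMaxPrinciple
  (hasFDerivAt_barrier_slice contDiff_barrier_slice laplacian_barrier_slice)

/-! ### The maximum principle, touching form -/

set_option maxHeartbeats 400000 in
/-- **WEAK MAXIMUM PRINCIPLE ON THE WHOLE SPACE, PENALISED form.**  As `…TouchingMaxPrinciple.le_of_subsolution_touching`, and in addition
the user may assume that `y ↦ q(t,y) − εe^{K(t−s₀)}(1 + ‖y‖²)` attains its global maximum over `ℝ³` at the point `x`. -/
theorem le_of_subsolution_penalised {q : ℝ → (EuclideanSpace ℝ (Fin 3)) → ℝ} {b : ℝ → (EuclideanSpace ℝ (Fin 3)) → (EuclideanSpace ℝ (Fin 3))} {s₀ s₁ Λ B m ε₀ : ℝ} (hΛ : 0 ≤ Λ) (hε₀ : 0 < ε₀)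
    (hcont : ContinuousOn (uncurry q) (Icc s₀ s₁ ×ˢ univ))
    (hB : ∀ t ∈ Icc s₀ s₁, ∀ x, q t x ≤ B)
    (hinit : ∀ x, q s₀ x ≤ m)
    (hsub : ∀ t ∈ Ioc s₀ s₁, ∀ x, m < q t x →
      ‖b t x‖ ≤ Λ ∧ (∃ U : Set (EuclideanSpace ℝ (Fin 3)), IsOpen U ∧ x ∈ U ∧ ContDiffOn ℝ 2 (q t) U) ∧
      (∃ d : ℝ, HasDerivAt (fun τ => q τ x) d t ∧
        (0 < d → ∀ ε : ℝ, 0 < ε → ε ≤ ε₀ → ε * (1 + ‖x‖ ^ 2) ≤ q t x - m →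
          fderiv ℝ (q t) x = ε • (Real.exp ((2 * Λ + 6) * (t - s₀)) • ((2 : ℝ) • innerSL ℝ x)) →
          (∀ y, q t y - ε * (Real.exp ((2 * Λ + 6) * (t - s₀)) * (1 + ‖y‖ ^ 2)) ≤
            q t x - ε * (Real.exp ((2 * Λ + 6) * (t - s₀)) * (1 + ‖x‖ ^ 2))) →
          d + fderiv ℝ (q t) x (b t x) - (Δ (q t)) x ≤ 0))) :
    ∀ t ∈ Icc s₀ s₁, ∀ x, q t x ≤ m := by
  intro t ht x
  by_contra hlt
  push Not at hlt
  set K : ℝ := 2 * Λ + 6 with hK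
  have hK0 : 0 ≤ K := by positivity
  set ψ : ℝ → (EuclideanSpace ℝ (Fin 3)) → ℝ := fun τ y => Real.exp (K * (τ - s₀)) * (1 + ‖y‖ ^ 2) with hψ
  have hψpos : ∀ τ y, 0 < ψ τ y := fun τ y => by positivity
  have hψge : ∀ τ, s₀ ≤ τ → ∀ y, 1 + ‖y‖ ^ 2 ≤ ψ τ y := by
    intro τ hτ y
    have : 1 ≤ Real.exp (K * (τ - s₀)) := Real.one_le_exp (by nlinarith)
    have h0 : 0 ≤ 1 + ‖y‖ ^ 2 := by positivity
    nlinarith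
  -- the perturbation parameters
  set η : ℝ := q t x - m with hη
  have hηpos : 0 < η := by linarith
  set ε : ℝ := min (η / (4 * ψ t x)) ε₀ with hε
  have hεpos : 0 < ε := lt_min (by positivity) hε₀
  have hεle : ε ≤ η / (4 * ψ t x) := min_le_left _ _
  have hεε₀ : ε ≤ ε₀ := min_le_right _ _
  set δ : ℝ := η / (4 * (s₁ - s₀ + 1)) with hδ
  have hs01 : s₀ ≤ s₁ := ht.1.trans ht.2
  have hδpos : 0 < δ := by rw [hδ]; exact div_pos hηpos (by linarith)
  set Φ : ℝ → (EuclideanSpace ℝ (Fin 3)) → ℝ := fun τ y => q τ y - ε * ψ τ y - δ * (τ - s₀) with hΦ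
  have hΦtx : m + η / 2 ≤ Φ t x := by
    have e1 : ε * ψ t x ≤ η / 4 := by
      have h := mul_le_mul_of_nonneg_right hεle (hψpos t x).le
      have e : η / (4 * ψ t x) * ψ t x = η / 4 := by field_simp [(hψpos t x).ne']
      linarith [h, e.le, e.ge]
    have e2 : δ * (t - s₀) ≤ η / 4 := by
      rw [hδ, div_mul_eq_mul_div, div_le_iff₀ (by linarith)]
      nlinarith [ht.1, ht.2]
    show m + η / 2 ≤ q t x - ε * ψ t x - δ * (t - s₀)
    linarith
  -- the radius beyond which `Φ < m`
  set R : ℝ := ‖x‖ + 1 + |B - m + 1| / ε with hR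
  have hR1 : 1 ≤ R := by
    have : 0 ≤ |B - m + 1| / ε := by positivity
    rw [hR]; nlinarith [norm_nonneg x]
  have hxR : ‖x‖ < R := by
    have : 0 ≤ |B - m + 1| / ε := by positivity
    rw [hR]; linarith
  have hfar : ∀ τ ∈ Icc s₀ s₁, ∀ y : (EuclideanSpace ℝ (Fin 3)), R ≤ ‖y‖ → Φ τ y ≤ m - 1 := by
    intro τ hτ y hy
    have h1 : ε * R ^ 2 ≥ |B - m + 1| := by
      have hR2 : R ≤ R ^ 2 := by nlinarith
      have : |B - m + 1| / ε ≤ R := by rw [hR]; linarith [norm_nonneg x]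
      rw [div_le_iff₀ hεpos] at this
      nlinarith
    have h2 : ε * ψ τ y ≥ ε * (1 + ‖y‖ ^ 2) := mul_le_mul_of_nonneg_left (hψge τ hτ.1 y) hεpos.le
    have h3 : ‖y‖ ^ 2 ≥ R ^ 2 := by nlinarith [norm_nonneg y]
    have h4 : 0 ≤ δ * (τ - s₀) := mul_nonneg hδpos.le (by linarith [hτ.1])
    have h5 := hB τ hτ y
    have h6 := le_abs_self (B - m + 1)
    show q τ y - ε * ψ τ y - δ * (τ - s₀) ≤ m - 1
    nlinarith
  -- continuity of `Φ` on the compact cylinder and a maximum point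
  set S : Set (ℝ × (EuclideanSpace ℝ (Fin 3))) := Icc s₀ s₁ ×ˢ closedBall (0 : (EuclideanSpace ℝ (Fin 3))) R with hS
  have hSc : IsCompact S := isCompact_Icc.prod (isCompact_closedBall _ _)
  have hSne : S.Nonempty := ⟨(t, x), ht, mem_closedBall_zero_iff.2 hxR.le⟩
  have hΦc : ContinuousOn (uncurry Φ) S := by
    have hq : ContinuousOn (uncurry q) S := hcont.mono (prod_mono Subset.rfl (subset_univ _))
    have hψc : Continuous (uncurry ψ) := by
      show Continuous fun p : ℝ × (EuclideanSpace ℝ (Fin 3)) => Real.exp (K * (p.1 - s₀)) * (1 + ‖p.2‖ ^ 2)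
      fun_prop
    have hlin : Continuous fun p : ℝ × (EuclideanSpace ℝ (Fin 3)) => δ * (p.1 - s₀) := by fun_prop
    have : ContinuousOn (fun p : ℝ × (EuclideanSpace ℝ (Fin 3)) => uncurry q p - ε * uncurry ψ p - δ * (p.1 - s₀)) S :=
      (hq.sub (hψc.continuousOn.const_smul ε |>.congr fun p _ => by simp [smul_eq_mul])).sub hlin.continuousOn
    exact this.congr fun p _ => by simp [hΦ, uncurry]
  obtain ⟨p₁, hp₁S, hmax⟩ := hSc.exists_isMaxOn hSne hΦc
  obtain ⟨t₁, x₁⟩ := p₁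
  obtain ⟨ht₁, hx₁⟩ : t₁ ∈ Icc s₀ s₁ ∧ x₁ ∈ closedBall (0 : (EuclideanSpace ℝ (Fin 3))) R := hp₁S
  have hge : Φ t x ≤ Φ t₁ x₁ := hmax (show ((t, x) : ℝ × (EuclideanSpace ℝ (Fin 3))) ∈ S from ⟨ht, mem_closedBall_zero_iff.2 hxR.le⟩)
  have hΦ₁ : m + η / 2 ≤ Φ t₁ x₁ := hΦtx.trans hge
  -- `t₁ > s₀`
  have ht₁0 : s₀ < t₁ := by
    rcases ht₁.1.eq_or_lt with h | h
    · exfalso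
      have h1 : Φ t₁ x₁ ≤ q t₁ x₁ := by
        show q t₁ x₁ - ε * ψ t₁ x₁ - δ * (t₁ - s₀) ≤ q t₁ x₁
        nlinarith [hψpos t₁ x₁, h]
      have h2 : q t₁ x₁ ≤ m := by rw [← h]; exact hinit x₁
      linarith
    · exact h
  -- `‖x₁‖ < R`
  have hx₁R : ‖x₁‖ < R := by
    by_contra hc
    push Not at hc
    linarith [hfar t₁ ht₁ x₁ hc]
  -- `q(t₁,x₁) > m`
  have hq₁ : m < q t₁ x₁ := by
    have h1 : Φ t₁ x₁ ≤ q t₁ x₁ := by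
      show q t₁ x₁ - ε * ψ t₁ x₁ - δ * (t₁ - s₀) ≤ q t₁ x₁
      nlinarith [hψpos t₁ x₁, ht₁.1, hδpos]
    linarith
  obtain ⟨hb, ⟨U, hU, hxU, hqU⟩, ⟨d, hd, hineq0⟩⟩ := hsub t₁ ⟨ht₁0, ht₁.2⟩ x₁ hq₁
  -- the penalisation bound `ε(1 + ‖x₁‖²) ≤ ε ψ(t₁,x₁) ≤ q(t₁,x₁) − m`
  have hεψ : ε * (1 + ‖x₁‖ ^ 2) ≤ q t₁ x₁ - m := by
    have h1 : ε * (1 + ‖x₁‖ ^ 2) ≤ ε * ψ t₁ x₁ := mul_le_mul_of_nonneg_left (hψge t₁ ht₁.1 x₁) hεpos.le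
    have h2 : ε * ψ t₁ x₁ ≤ q t₁ x₁ - m := by
      have h3 : m + η / 2 ≤ q t₁ x₁ - ε * ψ t₁ x₁ - δ * (t₁ - s₀) := hΦ₁
      nlinarith [hδpos, ht₁.1, hηpos]
    exact h1.trans h2
  -- spatial conditions at the interior maximum
  have hloc : IsLocalMax (Φ t₁) x₁ := by
    have hball : ball (0 : (EuclideanSpace ℝ (Fin 3))) R ∈ 𝓝 x₁ := isOpen_ball.mem_nhds (mem_ball_zero_iff.2 hx₁R)
    filter_upwards [hball] with y hy
    exact hmax (show ((t₁, y) : ℝ × (EuclideanSpace ℝ (Fin 3))) ∈ S from ⟨ht₁, ball_subset_closedBall hy⟩)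
  have hΦC2 : ContDiffOn ℝ 2 (Φ t₁) U := by
    show ContDiffOn ℝ 2 (fun y => q t₁ y - ε * ψ t₁ y - δ * (t₁ - s₀)) U
    exact (hqU.sub (contDiff_const.mul (contDiff_barrier_slice (K * (t₁ - s₀)))).contDiffOn).sub contDiffOn_const
  have hΔΦ : (Δ (Φ t₁)) x₁ ≤ 0 := laplacian_nonpos_of_isLocalMax_of_contDiffOn hU hxU hΦC2 hloc
  have hqC2 : ContDiffAt ℝ 2 (q t₁) x₁ := hqU.contDiffAt (hU.mem_nhds hxU)
  have hψC2 : ContDiffAt ℝ 2 (fun y => ε * ψ t₁ y) x₁ :=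
    (contDiff_const.mul (contDiff_barrier_slice (K * (t₁ - s₀)))).contDiffAt
  have hΔsplit : (Δ (Φ t₁)) x₁ = (Δ (q t₁)) x₁ - ε * (Real.exp (K * (t₁ - s₀)) * 6) := by
    have e1 : Φ t₁ = (q t₁ - fun y => ε * ψ t₁ y) - fun _ => δ * (t₁ - s₀) := by
      funext y; simp [hΦ]
    have h12 : ContDiffAt ℝ 2 (q t₁ - fun y => ε * ψ t₁ y) x₁ := hqC2.sub hψC2
    rw [e1, ContDiffAt.laplacian_sub h12 contDiffAt_const, ContDiffAt.laplacian_sub hqC2 hψC2]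
    have e2 : (fun y => ε * ψ t₁ y) = ε • fun y : (EuclideanSpace ℝ (Fin 3)) => Real.exp (K * (t₁ - s₀)) * (1 + ‖y‖ ^ 2) := by
      funext y; simp [hψ, smul_eq_mul]
    rw [e2, InnerProductSpace.laplacian_smul ε (contDiff_barrier_slice (K * (t₁ - s₀))).contDiffAt,
      laplacian_barrier_slice]
    simp [InnerProductSpace.laplacian_const, smul_eq_mul]
  have hDΦ : fderiv ℝ (Φ t₁) x₁ = 0 := hloc.fderiv_eq_zero
  have hgrad : fderiv ℝ (q t₁) x₁ = ε • (Real.exp (K * (t₁ - s₀)) • ((2 : ℝ) • innerSL ℝ x₁)) := by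
    have hψD := (hasFDerivAt_barrier_slice (K * (t₁ - s₀)) x₁).const_mul ε
    have hqD : HasFDerivAt (q t₁) (fderiv ℝ (q t₁) x₁) x₁ :=
      (hqC2.differentiableAt (by norm_num)).hasFDerivAt
    have hΦD : HasFDerivAt (Φ t₁) (fderiv ℝ (q t₁) x₁ - ε • (Real.exp (K * (t₁ - s₀)) • ((2 : ℝ) • innerSL ℝ x₁))) x₁ := by
      have h := (hqD.sub hψD).sub_const (δ * (t₁ - s₀))
      exact h.congr_fderiv rfl
    have h0 := hΦD.fderiv
    rw [hDΦ] at h0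
    rw [eq_comm, sub_eq_zero] at h0; exact h0
  have hDq : fderiv ℝ (q t₁) x₁ (b t₁ x₁) = ε * (Real.exp (K * (t₁ - s₀)) * (2 * ⟪x₁, b t₁ x₁⟫_ℝ)) := by
    rw [hgrad]
    simp [smul_eq_mul]
  -- the time condition: `τ ↦ Φ τ x₁` is maximal at `t₁` on `[s₀, t₁]`
  have hψt : HasDerivAt (fun τ => ψ τ x₁) (K * ψ t₁ x₁) t₁ := by
    show HasDerivAt (fun τ => Real.exp (K * (τ - s₀)) * (1 + ‖x₁‖ ^ 2))
      (K * (Real.exp (K * (t₁ - s₀)) * (1 + ‖x₁‖ ^ 2))) t₁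
    have h1 : HasDerivAt (fun τ => K * (τ - s₀)) K t₁ := by
      simpa using ((hasDerivAt_id t₁).sub_const s₀).const_mul K
    have h2 := (h1.exp).mul_const (1 + ‖x₁‖ ^ 2)
    refine h2.congr_deriv ?_
    ring
  have hΦt : HasDerivAt (fun τ => Φ τ x₁) (d - ε * (K * ψ t₁ x₁) - δ) t₁ := by
    have h1 : HasDerivAt (fun τ => δ * (τ - s₀)) δ t₁ := by
      simpa using ((hasDerivAt_id t₁).sub_const s₀).const_mul δ
    exact (hd.sub (hψt.const_mul ε)).sub h1
  have hDt : 0 ≤ d - ε * (K * ψ t₁ x₁) - δ := by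
    have e : s₀ + (t₁ - s₀) = t₁ := by ring
    have hΦt' : HasDerivAt (fun τ => Φ τ x₁) (d - ε * (K * ψ t₁ x₁) - δ) (s₀ + (t₁ - s₀)) := by rw [e]; exact hΦt
    have hsh : HasDerivAt (fun r => Φ (s₀ + r) x₁) (d - ε * (K * ψ t₁ x₁) - δ) (t₁ - s₀) :=
      HasDerivAt.comp_const_add s₀ (t₁ - s₀) hΦt'
    refine Literature.Analysis.PDE.deriv_nonneg_of_isMaxOn_Icc_left (w := fun r => Φ (s₀ + r) x₁)
      (D := d - ε * (K * ψ t₁ x₁) - δ) (t₀ := t₁ - s₀) (s := univ) (by linarith) (subset_univ _)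
      hsh.hasDerivWithinAt fun r hr => ?_
    show Φ (s₀ + r) x₁ ≤ Φ (s₀ + (t₁ - s₀)) x₁
    rw [e]
    exact hmax (show ((s₀ + r, x₁) : ℝ × (EuclideanSpace ℝ (Fin 3))) ∈ S from ⟨⟨by linarith [hr.1], by linarith [hr.2, ht₁.2]⟩, hx₁⟩)
  -- `d > 0`, and the subsolution inequality at the touching point
  have hdpos : 0 < d := by
    have : 0 < ε * (K * ψ t₁ x₁) + δ := by
      have := hψpos t₁ x₁
      positivity
    linarith
  have hglob : ∀ y, q t₁ y - ε * (Real.exp ((2 * Λ + 6) * (t₁ - s₀)) * (1 + ‖y‖ ^ 2)) ≤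
      q t₁ x₁ - ε * (Real.exp ((2 * Λ + 6) * (t₁ - s₀)) * (1 + ‖x₁‖ ^ 2)) := by
    intro y
    have hK' : (2 * Λ + 6) = K := by rw [hK]
    rw [hK']
    have key : Φ t₁ y ≤ Φ t₁ x₁ := by
      by_cases hy : ‖y‖ ≤ R
      · exact hmax (show ((t₁, y) : ℝ × (EuclideanSpace ℝ (Fin 3))) ∈ S from ⟨ht₁, mem_closedBall_zero_iff.2 hy⟩)
      · push Not at hy
        have h1 := hfar t₁ ht₁ y hy.le
        linarith
    show q t₁ y - ε * ψ t₁ y ≤ q t₁ x₁ - ε * ψ t₁ x₁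
    have e1 : Φ t₁ y = q t₁ y - ε * ψ t₁ y - δ * (t₁ - s₀) := rfl
    have e2 : Φ t₁ x₁ = q t₁ x₁ - ε * ψ t₁ x₁ - δ * (t₁ - s₀) := rfl
    linarith
  have hineq : d + fderiv ℝ (q t₁) x₁ (b t₁ x₁) - (Δ (q t₁)) x₁ ≤ 0 := by
    exact hineq0 hdpos ε hεpos hεε₀ hεψ hgrad hglob
  -- the barrier is a supersolution: `K(1+‖x‖²) − 2Λ‖x‖ − 2n ≥ 0`
  have hbar : 0 ≤ K * (1 + ‖x₁‖ ^ 2) - 2 * Λ * ‖x₁‖ - 6 := by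
    have hN := norm_nonneg x₁
    have h1 : 0 ≤ 1 + ‖x₁‖ ^ 2 - ‖x₁‖ := by nlinarith [sq_nonneg (‖x₁‖ - 1)]
    have e : K * (1 + ‖x₁‖ ^ 2) - 2 * Λ * ‖x₁‖ - 6 = 2 * Λ * (1 + ‖x₁‖ ^ 2 - ‖x₁‖) + 6 * ‖x₁‖ ^ 2 := by
      rw [hK]; ring
    rw [e]
    exact add_nonneg (mul_nonneg (by positivity) h1) (by positivity)
  have hinner : -(‖x₁‖ * Λ) ≤ ⟪x₁, b t₁ x₁⟫_ℝ := by
    have h1 := real_inner_le_norm x₁ (b t₁ x₁)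
    have h2 := abs_real_inner_le_norm x₁ (b t₁ x₁)
    have h3 : ‖x₁‖ * ‖b t₁ x₁‖ ≤ ‖x₁‖ * Λ := mul_le_mul_of_nonneg_left hb (norm_nonneg _)
    have := neg_abs_le ⟪x₁, b t₁ x₁⟫_ℝ
    linarith
  -- combine: `d + Dq[b] − Δq ≥ δ + ε e^{K(t₁−s₀)} (K(1+‖x₁‖²) − 2Λ‖x₁‖ − 2n) > 0`
  obtain ⟨P, hP⟩ : ∃ P : ℝ, P = ε * Real.exp (K * (t₁ - s₀)) := ⟨_, rfl⟩
  have hP0 : 0 ≤ P := by rw [hP]; positivity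
  have hψval : ψ t₁ x₁ = Real.exp (K * (t₁ - s₀)) * (1 + ‖x₁‖ ^ 2) := rfl
  rw [hψval] at hDt
  have e1 : ε * (K * (Real.exp (K * (t₁ - s₀)) * (1 + ‖x₁‖ ^ 2))) = K * P * (1 + ‖x₁‖ ^ 2) := by rw [hP]; ring
  have F1 : K * P * (1 + ‖x₁‖ ^ 2) + δ ≤ d := by linarith [hDt, e1.le, e1.ge]
  have e2 : ε * (Real.exp (K * (t₁ - s₀)) * (2 * ⟪x₁, b t₁ x₁⟫_ℝ)) = 2 * P * ⟪x₁, b t₁ x₁⟫_ℝ := by rw [hP]; ring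
  have e3 : ε * (Real.exp (K * (t₁ - s₀)) * 6) = 6 * P := by rw [hP]; ring
  rw [hDq, e2] at hineq
  have F3 : (Δ (q t₁)) x₁ ≤ 6 * P := by rw [hΔsplit, e3] at hΔΦ; linarith
  have F4 : -(2 * P * (‖x₁‖ * Λ)) ≤ 2 * P * ⟪x₁, b t₁ x₁⟫_ℝ := by
    have h := mul_le_mul_of_nonneg_left hinner (by positivity : (0 : ℝ) ≤ 2 * P)
    rwa [mul_neg] at h
  have F5 : 0 ≤ K * P * (1 + ‖x₁‖ ^ 2) - 2 * P * (‖x₁‖ * Λ) - 6 * P := by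
    have h := mul_nonneg hP0 hbar
    have e5 : P * (K * (1 + ‖x₁‖ ^ 2) - 2 * Λ * ‖x₁‖ - 6) =
        K * P * (1 + ‖x₁‖ ^ 2) - 2 * P * (‖x₁‖ * Λ) - 6 * P := by ring
    linarith [h, e5.le, e5.ge]
  linarith [F1, F3, F4, F5, hineq, hδpos]

end Summit.NavierStokesRegularity.NavierStokesRegularity.Theorems.HalfSpaceWindowDoorCirculationCarryingRigidityPenalisedMaxPrinciple

end
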